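import Summits.QuantumFields.YangMills.Theorems.BalabanUVNodesN19RekeyingAscent
import Summits.QuantumFields.YangMills.Theorems.BalabanUVNodesN19PureShellClasses

/-!
# BalabanUVNodes ∕ node N19 (NE7) — WHAT THE HYBRID BINDER LIST ASKS BEYOND NODE U5's DECL TARGET, EXACTLY: given NE7b (N20) and NE7c (N21),
# `T4MatchingAssembly.HybridNE7` ⟺ `Spine.NE7.Target` at the partition functions ∧ ONE summable, constant-free letter — the per-source
# homogeneity of the good classes' shell-free cores

Cell `pub-ymgap` (HUMAN RULING D-0062 Track A ∕ D-0149 width seats), WIDTH SEAT `pub-ymgap-dag-n19-w1` (node n19 = NE7, seat 1 of 3), generation g3,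
INTENT-2.  Route `Summits/QuantumFields/YangMills/Theses/BalabanUVNodes.lean`, key item K3⁷ `SpineGivenEndpointR13SepCoPH` (stmt-QuantumFields-20544); filed
`--kind proof --supports … --as helper`.  COUNT-NEUTRAL.  THEOREMS ONLY (0 `def`, 0 `sorry`).  ADDITIVE — imports this seat's g3 `…Theorems.BalabanUVNodesN19RekeyingAscent`
(INTENT-1: `sandwich_sum`, `abs_sub_le_of_two_sandwiches`, `sandwich_widen`; through it dag-n19-e's `…N19CoreMetric`: `exists_center_of_pairwise_le`,
`logRatio_sub_logRatio_le_of_core`) and this seat's g0 `…Theorems.BalabanUVNodesN19PureShellClasses` (p586135: `goodCoreSum_sandwich_of_total`); the tree's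
`Spine/NE7/Targets` (`Core`, `Target`, `sandwich_of_abs_log_sub_le`, `hybridNE7_of_core`, `target_of_hybridNE7`), `T4CauchySum` (`MatchingModConstants`,
`two_sided_of_abs_log_sub_le`), `T4HybridMatching` (`hybridDelta`, `summable_hybridDelta`) — all CITED BY NAME; modifies nothing.

WHY.  Node U5's DECL target is `Spine.NE7.Target vol l₀ δ Z := T4CauchySum.MatchingModConstants vol l₀ δ Z ∧ Summable δ` — a statement about the two runs' dressed
PARTITION FUNCTIONS `Z K t = Σ_T A K t`, `Z (K+1) t = Σ_T B K t` alone.  The road the spine chose (K3's `S_N19`, leaf D's `h19`, K3⁷ v4 stub 2's `KeyedCoreEdgeHolderD4`) is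
the HYBRID BINDER LIST `T4MatchingAssembly.HybridNE7 l₀ vol T A B Bad W shA shB Wsh δ` = NE7b `RelWeightBound` (node N20) ∧ NE7c `ShellWeightBound` (node N21) ∧ `W + Wsh < 1` ∧
`Summable δ` ∧ `Core` on the good classes' shell-free cores (node N19′), and `HybridNE7 ⇒ Target` is the tree's `target_of_hybridNE7`.  The tree records that the
converse FAILS (dag-n19-e `…N19CoreMetric` §4 «N19's Target is the SUFFICIENT road the spine chose, strictly stronger than U0's input»; `…N19SourceSplitGuards` «the vacuum
half is load-bearing on the `Core` road and invisible at the Z-level»; this seat's g0 `exists_totalCore_not_core`) and that with ONE good class per level it HOLDS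
(g0 `hybridNE7_twoClass_of_total`: «the hybrid binder list carries no information beyond total matching + N20∕N21's weights»).  This file closes the bracket for ANY
number of good classes: GIVEN N20's and N21's weights, the binder list exceeds the DECL target by EXACTLY ONE LETTER, constant-free and summable —
  `Hom(ε)`: at every `(K, t)`, `|t| ≤ l₀`, the log-ratio `log (B − shB) − log (A − shA)` of the good classes' cores has pairwise CLASS-oscillation `≤ 2·vol·ε_K`
(INTENT-1's fibrewise letter `Fib` at the collapse key, in its oscillation form; stated inline, no definition).  No vacuum ∕ insertion split, no matching constant.
* §1 [folklore] ★★ `core_of_goodTotals_of_classOsc` — positive good cores `P`, `Q`, a ONE-CONSTANT SOURCE-UNIFORM sandwich of the GOOD-CORE TOTALS `Σ_{T∖Bad} P`, `Σ_{T∖Bad} Q`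
  (rate `η`) and `Hom(ε)` ⇒ `Core l₀ vol T Bad P Q (η + 2ε)` with the constants of the totals (INTENT-1 §5 with a bad class present: centre of the log-ratios per `(K,t)`,
  sum the class sandwich over the good classes, pin the centre to `c_K` on the positive pair of good totals, widen).
* §2 [folklore ∘ g0 BY NAME] ★★ `hybridNE7_of_matchingModConstants_of_classOsc` — THE CONVERSE ROAD: `MatchingModConstants vol l₀ δ Z` (positive `Z`, the E1∕E2 dictionary) +
  NE7b + NE7c + `W + Wsh < 1` + `Summable δ` + positive good cores + `Hom(ε)` summable ⇒ `HybridNE7 … (hybridDelta vol δ (W + Wsh) + 2ε)` — g0's un-hybrid bridge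
  `goodCoreSum_sandwich_of_total` (totals ⇒ good-core totals at radius `vol·hybridDelta`) ∘ §1 ∘ `NE7.hybridNE7_of_core`.
* §3 [folklore] `classOsc_of_hybridNE7` (NECESSITY of `Hom`: `HybridNE7 … δ` with positive run-A good cores ⇒ `Hom(δ)`, `N19CoreMetric.logRatio_sub_logRatio_le_of_core` at `t = t′`).
* §4 [folklore] ★★★ `hybridNE7Edge_iff_target_classOsc` — GIVEN N20 ∕ N21 (`RelWeightBound`, `ShellWeightBound`, `W + Wsh < 1`), the dictionary and positivity:
  `(∃ δ, HybridNE7 … δ) ↔ (∃ δ, NE7.Target vol l₀ δ Z) ∧ (∃ ε, Hom(ε) ∧ Summable ε)` · ★★ `coreEdge_iff_target_classOsc` — the same for N19′'s OWN slot, leaf D's `h19` shape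
  `∃ δ, Core … (A − shA) (B − shB) δ ∧ Summable δ`: AT FIXED WEIGHTS, N19′ ⟺ node U5's DECL target ∧ `Hom` summable.
* §5 [folklore] `classOsc_of_goodSubsingleton` · ★ `hybridNE7_of_matchingModConstants_of_goodSubsingleton` — at most ONE good class per `(K, t)`: `Hom(0)` is automatic and §2
  returns `HybridNE7 … (hybridDelta vol δ (W + Wsh))` from the DECL target and the weights ALONE — g0's `hybridNE7_twoClass_of_total` (index `Bool`, bad class `{true}`) for an
  arbitrary index and bad-class family: the bracket's lower end.
* §6 [folklore] ★ `not_coreEdge_of_unsummable_gap` ∕ `not_hybridNE7Edge_of_unsummable_gap` — THE DISPROVER's HANDLE: two good classes per level whose log-ratio gap `g_K ≥ 0` is NOT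
  summable exclude `∃ δ, Core ∧ Summable δ` ∕ `∃ δ, HybridNE7 … δ` AT THAT READING, whatever the weights (g0's `exists_totalCore_not_core` as a criterion).
* §7 [folklore] `classOsc_of_vacuumOsc_of_responseOsc` · ★★ `hybridNE7_of_matchingModConstants_of_vacuumOsc_of_responseOsc` · `vacuumOsc_responseOsc_of_hybridNE7` — `Hom`
  SPLIT ALONG THE SOURCE into (V₀) vacuum class-homogeneity (dag-n19-e's (V), constant-free form) and (H) class-homogeneity of the source RESPONSE — (H) is WEAKER than dag-n19-e's
  per-class response letter (I): the response common to all good classes is booked by the DECL target, so the three letters (target, V₀, H) carry every matching constant in the target alone.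
READINGS (for the planner; located, nothing proposed).  (i) K3⁷ v4 stub 2 bundles N20 (`KeyedRelWeight`), N21 (`KeyedShellWeight`), N27x (`KeyedExtraction` = the E1∕E2
dictionary + positivity) and N19′ (`KeyedCoreEdgeHolderD4`); by §4, AT ANY FIXED CHOICE of the first three, N19′'s conjunct is EQUIVALENT to «node U5's DECL target
`∃ δ, Target vol l₀ δ Z` at the string's dressed partition functions ∧ a summable `Hom`» — so the `Core` road costs, beyond the node's own target, exactly the
per-source class-homogeneity of the good cores at the reading's key, and (INTENT-1 §3) that letter is additive along coarsenings of the key.  (ii) The letter is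
genuinely extra (g0 `exists_totalCore_not_core`: two good classes, `Target` with `δ = 0`, `Hom(ε_K)` forces `log 2 ≤ 2·vol·ε_K`) and genuinely free at one good class (§5).
(iii) For the disprover: a reading meeting N20 ∕ N21 ∕ N27x and the DECL target but violating a summable `Hom` on two good classes refutes stub 2's N19′ conjunct AT THAT
READING (not the crux: the dials `jc`, `sh`, the key are the prover's).

HONEST FRAMING.  Finite-sum ∕ elementary real-analysis bookkeeping [folklore] over the tree's SHAPES; `Hom`, `Core`, `Target`, `MatchingModConstants`, `RelWeightBound`,
`ShellWeightBound`, `HybridNE7` occur as HYPOTHESES only; nothing of Bałaban's is asserted or instantiated; no estimate of the programme is proved.  NE7 ∕ NE7b ∕ NE7c are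
NOT PRINTED as two-run statements for d = 4 ([Balaban1987RG1]–[Balaban1989LargeFieldII] bound ONE run uniformly in `ε`; [King1986] (3.10)–(3.13) pp. 656–657 is a d = 2, 3
TEMPLATE, context only) and NOT proved; N19 ∕ N20 ∕ N21 NOT discharged; K3⁷ OPEN, not claimed; counts UNMOVED (typed 28∕28 · discharged 5∕27, A 5∕28).  Everything below
is PROVED (0 `sorry`, 0 named facts, standard axioms); no decl carries a cite tag.  One finite four-torus programme at fixed ε — NOT ℝ⁴, NOT infinite volume, NOT OS, NOT
a mass gap, NOT the Clay problem (R4 closes the conditional finite-𝕋⁴ rung `BalabanLadder.UV` only).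
-/

noncomputable section

namespace Summit.QuantumFields.YangMills.BalabanUVNodes.N19HybridBeyondTarget

open Finset
open Summit.QuantumFields.BalabanUV.T4Continuum.Spine.NE7 (Core Target sandwich_of_abs_log_sub_le hybridNE7_of_core target_of_hybridNE7)
open Literature.MathematicalPhysics.QuantumFieldTheory.Balaban1983to89
open T4CauchySum (MatchingModConstants two_sided_of_abs_log_sub_le)
open T4WeightBudget (RelWeightBound)
open T4IndicatorShell (ShellWeightBound)
open T4MatchingAssembly (HybridNE7)
open T4HybridMatching (hybridDelta summable_hybridDelta)
open Summit.QuantumFields.YangMills.BalabanUVNodes.N19RekeyingAscent (sandwich_sum abs_sub_le_of_two_sandwiches sandwich_widen)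
open Summit.QuantumFields.YangMills.BalabanUVNodes.N19CoreMetric (exists_center_of_pairwise_le logRatio_sub_logRatio_le_of_core)
open Summit.QuantumFields.YangMills.BalabanUVNodes.N19PureShellClasses (goodCoreSum_sandwich_of_total)

variable {ι : Type*} [DecidableEq ι] {l₀ vol : ℝ} {T : ℕ → Finset ι} {Bad : ℕ → ℝ → Finset ι}

/-! ## §1 Good-core totals (one constant, uniform in the source) + per-source class-homogeneity ⇒ `Core` [folklore] -/

section GoodTotals
variable {P Q : ℕ → ℝ → ι → ℝ} {η ε : ℕ → ℝ}

/-- **★★ `Core` FROM THE GOOD-CORE TOTALS AND `Hom`** [folklore].  Positive cores on the good classes, (a) a ONE-CONSTANT, SOURCE-UNIFORM sandwich of the good-core totals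
`e^{c_K − vol·η_K}·Σ_{T∖Bad} P ≤ Σ_{T∖Bad} Q ≤ e^{c_K + vol·η_K}·Σ_{T∖Bad} P` on `|t| ≤ l₀`, and (b) `Hom(ε)`: at each `(K, t)` the log-ratio `log Q − log P` has pairwise
class-oscillation `≤ 2·vol·ε_K` over the good classes ⇒ `Core l₀ vol T Bad P Q (η + 2ε)` with the constants `c_K` of the totals.  (Centre `r(K,t)` of the log-ratios by
`N19CoreMetric.exists_center_of_pairwise_le`; the class sandwich at `r(K,t)` sums over the good classes (`N19RekeyingAscent.sandwich_sum`); on the positive pair of good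
totals the two sandwiches pin `|r(K,t) − c_K| ≤ vol(ε_K + η_K)` (`abs_sub_le_of_two_sandwiches`); widen (`sandwich_widen`).) -/
theorem core_of_goodTotals_of_classOsc (hP : ∀ (K : ℕ) (t : ℝ), |t| ≤ l₀ → ∀ τ ∈ T K \ Bad K t, 0 < P K t τ)
    (hQ : ∀ (K : ℕ) (t : ℝ), |t| ≤ l₀ → ∀ τ ∈ T K \ Bad K t, 0 < Q K t τ)
    (hG : ∀ K : ℕ, ∃ c : ℝ, ∀ t : ℝ, |t| ≤ l₀ →
      Real.exp (c - vol * η K) * ∑ τ ∈ T K \ Bad K t, P K t τ ≤ ∑ τ ∈ T K \ Bad K t, Q K t τ ∧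
        ∑ τ ∈ T K \ Bad K t, Q K t τ ≤ Real.exp (c + vol * η K) * ∑ τ ∈ T K \ Bad K t, P K t τ)
    (hosc : ∀ (K : ℕ) (t : ℝ), |t| ≤ l₀ → ∀ τ ∈ T K \ Bad K t, ∀ τ' ∈ T K \ Bad K t,
      (Real.log (Q K t τ) - Real.log (P K t τ)) - (Real.log (Q K t τ') - Real.log (P K t τ')) ≤ 2 * (vol * ε K)) :
    Core l₀ vol T Bad P Q (fun K => η K + 2 * ε K) := by
  intro K
  obtain ⟨c, hc⟩ := hG K
  refine ⟨c, fun t ht τ hτ => ?_⟩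
  obtain ⟨r, hr⟩ := exists_center_of_pairwise_le
    (s := {x : ℝ | ∃ τ₁ ∈ T K \ Bad K t, x = Real.log (Q K t τ₁) - Real.log (P K t τ₁)}) (η := vol * ε K) (by
      rintro x ⟨τ₁, h₁, rfl⟩ y ⟨τ₂, h₂, rfl⟩
      exact sub_le_iff_le_add'.mp (hosc K t ht τ₁ h₁ τ₂ h₂))
  have hfib : ∀ τ' ∈ T K \ Bad K t, Real.exp (r - vol * ε K) * P K t τ' ≤ Q K t τ' ∧ Q K t τ' ≤ Real.exp (r + vol * ε K) * P K t τ' :=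
    fun τ' h' => sandwich_of_abs_log_sub_le (hP K t ht τ' h') (hQ K t ht τ' h') (hr _ ⟨τ', h', rfl⟩)
  have hsum := sandwich_sum hfib
  have hpos : 0 < ∑ τ' ∈ T K \ Bad K t, P K t τ' := Finset.sum_pos (fun τ' h' => hP K t ht τ' h') ⟨τ, hτ⟩
  have hring : vol * (η K + 2 * ε K) = (vol * ε K + vol * η K) + vol * ε K := by ring
  rw [hring]
  exact sandwich_widen (hP K t ht τ hτ).le (abs_sub_le_of_two_sandwiches hpos hsum.1 hsum.2 (hc t ht).1 (hc t ht).2) (hfib τ hτ)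

/-- The edge form: a SUMMABLE-rate sandwich of the good-core totals and a SUMMABLE `Hom` give `∃ δ, Core … P Q δ ∧ Summable δ` [folklore]. -/
theorem coreEdge_of_goodTotals_of_classOsc (hP : ∀ (K : ℕ) (t : ℝ), |t| ≤ l₀ → ∀ τ ∈ T K \ Bad K t, 0 < P K t τ)
    (hQ : ∀ (K : ℕ) (t : ℝ), |t| ≤ l₀ → ∀ τ ∈ T K \ Bad K t, 0 < Q K t τ)
    (hG : ∃ η : ℕ → ℝ, (∀ K : ℕ, ∃ c : ℝ, ∀ t : ℝ, |t| ≤ l₀ →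
      Real.exp (c - vol * η K) * ∑ τ ∈ T K \ Bad K t, P K t τ ≤ ∑ τ ∈ T K \ Bad K t, Q K t τ ∧
        ∑ τ ∈ T K \ Bad K t, Q K t τ ≤ Real.exp (c + vol * η K) * ∑ τ ∈ T K \ Bad K t, P K t τ) ∧ Summable η)
    (hosc : ∃ ε : ℕ → ℝ, (∀ (K : ℕ) (t : ℝ), |t| ≤ l₀ → ∀ τ ∈ T K \ Bad K t, ∀ τ' ∈ T K \ Bad K t,
      (Real.log (Q K t τ) - Real.log (P K t τ)) - (Real.log (Q K t τ') - Real.log (P K t τ')) ≤ 2 * (vol * ε K)) ∧ Summable ε) :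
    ∃ δ : ℕ → ℝ, Core l₀ vol T Bad P Q δ ∧ Summable δ := by
  obtain ⟨η, hG, hη⟩ := hG
  obtain ⟨ε, hosc, hε⟩ := hosc
  exact ⟨fun K => η K + 2 * ε K, core_of_goodTotals_of_classOsc hP hQ hG hosc, hη.add (hε.mul_left 2)⟩

end GoodTotals

/-! ## §2 The converse road: DECL target + NE7b + NE7c + `Hom` ⇒ the hybrid binder list [folklore ∘ g0 BY NAME] -/

section Hybrid
variable {A B shA shB : ℕ → ℝ → ι → ℝ} {W Wsh δ ε : ℕ → ℝ} {Z : ℕ → ℝ → ℝ}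

omit [DecidableEq ι] in
/-- The Z-level hypothesis read as a sandwich of the totals: `MatchingModConstants vol l₀ δ Z` for positive `Z` with the E1∕E2 dictionary `Z K t = Σ_T A`, `Z (K+1) t = Σ_T B`
is the one-constant, source-uniform sandwich `e^{c_K ∓ vol·δ_K}` of the totals (`T4CauchySum.two_sided_of_abs_log_sub_le` BY NAME). [folklore] -/
theorem totals_sandwich_of_matchingModConstants (hZA : ∀ (K : ℕ) (t : ℝ), |t| ≤ l₀ → Z K t = ∑ τ ∈ T K, A K t τ)
    (hZB : ∀ (K : ℕ) (t : ℝ), |t| ≤ l₀ → Z (K + 1) t = ∑ τ ∈ T K, B K t τ) (hZ : ∀ (K : ℕ) (t : ℝ), |t| ≤ l₀ → 0 < Z K t)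
    (hM : MatchingModConstants vol l₀ δ Z) :
    ∀ K : ℕ, ∃ c : ℝ, ∀ t : ℝ, |t| ≤ l₀ →
      Real.exp (c - vol * δ K) * ∑ τ ∈ T K, A K t τ ≤ ∑ τ ∈ T K, B K t τ ∧ ∑ τ ∈ T K, B K t τ ≤ Real.exp (c + vol * δ K) * ∑ τ ∈ T K, A K t τ := by
  intro K
  obtain ⟨c, hc⟩ := hM K
  refine ⟨c, fun t ht => ?_⟩
  have h := two_sided_of_abs_log_sub_le (hZ K t ht) (hZ (K + 1) t ht) (hc t ht)
  rw [hZA K t ht, hZB K t ht] at h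
  exact h

/-- **★★ THE CONVERSE ROAD** [folklore ∘ g0 BY NAME].  Node U5's DECL-target currency `MatchingModConstants vol l₀ δ Z` at positive partition functions with the E1∕E2 dictionary,
NE7b `RelWeightBound … Bad W`, NE7c `ShellWeightBound … shA shB Wsh`, `W + Wsh < 1`, `Summable δ`, positive shell-free cores on the good classes and a SUMMABLE `Hom(ε)` ⇒ the
hybrid binder list `HybridNE7 l₀ vol T A B Bad W shA shB Wsh (hybridDelta vol δ (W + Wsh) + 2ε)`: g0's `goodCoreSum_sandwich_of_total` turns the totals' sandwich into the
good-core totals' at radius `vol·hybridDelta` (the weights pay `−log(1 − W − Wsh)`), §1 turns that and `Hom` into `Core`, `NE7.hybridNE7_of_core` assembles. -/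
theorem hybridNE7_of_matchingModConstants_of_classOsc (hvol : 0 < vol) (hW : RelWeightBound l₀ T A B Bad W) (hSh : ShellWeightBound l₀ T A B shA shB Wsh)
    (hlt : ∀ K, W K + Wsh K < 1)
    (hZA : ∀ (K : ℕ) (t : ℝ), |t| ≤ l₀ → Z K t = ∑ τ ∈ T K, A K t τ) (hZB : ∀ (K : ℕ) (t : ℝ), |t| ≤ l₀ → Z (K + 1) t = ∑ τ ∈ T K, B K t τ)
    (hZ : ∀ (K : ℕ) (t : ℝ), |t| ≤ l₀ → 0 < Z K t) (hM : MatchingModConstants vol l₀ δ Z) (hδ : Summable δ)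
    (hP : ∀ (K : ℕ) (t : ℝ), |t| ≤ l₀ → ∀ τ ∈ T K \ Bad K t, 0 < A K t τ - shA K t τ)
    (hQ : ∀ (K : ℕ) (t : ℝ), |t| ≤ l₀ → ∀ τ ∈ T K \ Bad K t, 0 < B K t τ - shB K t τ)
    (hosc : ∀ (K : ℕ) (t : ℝ), |t| ≤ l₀ → ∀ τ ∈ T K \ Bad K t, ∀ τ' ∈ T K \ Bad K t,
      (Real.log (B K t τ - shB K t τ) - Real.log (A K t τ - shA K t τ)) - (Real.log (B K t τ' - shB K t τ') - Real.log (A K t τ' - shA K t τ'))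
        ≤ 2 * (vol * ε K))
    (hε : Summable ε) :
    HybridNE7 l₀ vol T A B Bad W shA shB Wsh (fun K => hybridDelta vol δ (fun K => W K + Wsh K) K + 2 * ε K) := by
  have hgood := goodCoreSum_sandwich_of_total hvol hW hSh hlt (totals_sandwich_of_matchingModConstants hZA hZB hZ hM)
  have hcore := core_of_goodTotals_of_classOsc (P := fun K t τ => A K t τ - shA K t τ) (Q := fun K t τ => B K t τ - shB K t τ)
    (η := hybridDelta vol δ fun K => W K + Wsh K) hP hQ hgood hosc
  exact hybridNE7_of_core hW hSh hlt
    ((summable_hybridDelta hδ (fun K => add_nonneg (hW.nonneg K) (hSh.nonneg K)) hlt (hW.summable.add hSh.summable)).add (hε.mul_left 2)) hcore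

/-! ## §3 Necessity of `Hom` [folklore] -/

/-- **`Hom` IS NECESSARY**: the hybrid binder list at rate `δ` with positive run-A good cores has, at every `(K, t)`, class-oscillation of the good cores' log-ratio `≤ 2·vol·δ_K`
(`N19CoreMetric.logRatio_sub_logRatio_le_of_core` at `t = t′`). [folklore] -/
theorem classOsc_of_hybridNE7 (h : HybridNE7 l₀ vol T A B Bad W shA shB Wsh δ)
    (hP : ∀ (K : ℕ) (t : ℝ), |t| ≤ l₀ → ∀ τ ∈ T K \ Bad K t, 0 < A K t τ - shA K t τ) :
    ∀ (K : ℕ) (t : ℝ), |t| ≤ l₀ → ∀ τ ∈ T K \ Bad K t, ∀ τ' ∈ T K \ Bad K t,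
      (Real.log (B K t τ - shB K t τ) - Real.log (A K t τ - shA K t τ)) - (Real.log (B K t τ' - shB K t τ') - Real.log (A K t τ' - shA K t τ'))
        ≤ 2 * (vol * δ K) :=
  fun K t ht τ hτ τ' hτ' => logRatio_sub_logRatio_le_of_core (P := fun K t τ => A K t τ - shA K t τ) (Q := fun K t τ => B K t τ - shB K t τ)
    h.core K ht ht hτ hτ' (hP K t ht τ hτ) (hP K t ht τ' hτ')

/-- `Hom` is necessary for N19′'s own slot as well: `Core … (A − shA) (B − shB) δ` with positive run-A good cores ⇒ `Hom(δ)`. [folklore] -/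
theorem classOsc_of_core (h : Core l₀ vol T Bad (fun K t τ => A K t τ - shA K t τ) (fun K t τ => B K t τ - shB K t τ) δ)
    (hP : ∀ (K : ℕ) (t : ℝ), |t| ≤ l₀ → ∀ τ ∈ T K \ Bad K t, 0 < A K t τ - shA K t τ) :
    ∀ (K : ℕ) (t : ℝ), |t| ≤ l₀ → ∀ τ ∈ T K \ Bad K t, ∀ τ' ∈ T K \ Bad K t,
      (Real.log (B K t τ - shB K t τ) - Real.log (A K t τ - shA K t τ)) - (Real.log (B K t τ' - shB K t τ') - Real.log (A K t τ' - shA K t τ'))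
        ≤ 2 * (vol * δ K) :=
  fun K t ht τ hτ τ' hτ' => logRatio_sub_logRatio_le_of_core h K ht ht hτ hτ' (hP K t ht τ hτ) (hP K t ht τ' hτ')

/-! ## §4 The bracket closed: given the weights, the binder list ⟺ DECL target ∧ summable `Hom` [folklore] -/

/-- **★★★ GIVEN N20 ∕ N21, `HybridNE7` ⟺ NODE U5's DECL TARGET ∧ A SUMMABLE `Hom`** [folklore].  Under NE7b, NE7c, `W + Wsh < 1`, the E1∕E2 dictionary at positive partition
functions, `0 < vol`, `0 ≤ l₀` and positive shell-free good cores in both runs: `(∃ δ, HybridNE7 … δ) ↔ (∃ δ, NE7.Target vol l₀ δ Z) ∧ (∃ ε, Hom(ε) ∧ Summable ε)`.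
⇒: `NE7.target_of_hybridNE7` (rate `hybridDelta vol δ (W + Wsh)`) and §3; ⇐: §2.  What the hybrid road asks BEYOND the node's own target, exactly. -/
theorem hybridNE7Edge_iff_target_classOsc (hvol : 0 < vol) (hl₀ : 0 ≤ l₀) (hW : RelWeightBound l₀ T A B Bad W) (hSh : ShellWeightBound l₀ T A B shA shB Wsh)
    (hlt : ∀ K, W K + Wsh K < 1)
    (hZA : ∀ (K : ℕ) (t : ℝ), |t| ≤ l₀ → Z K t = ∑ τ ∈ T K, A K t τ) (hZB : ∀ (K : ℕ) (t : ℝ), |t| ≤ l₀ → Z (K + 1) t = ∑ τ ∈ T K, B K t τ)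
    (hZ : ∀ (K : ℕ) (t : ℝ), |t| ≤ l₀ → 0 < Z K t)
    (hP : ∀ (K : ℕ) (t : ℝ), |t| ≤ l₀ → ∀ τ ∈ T K \ Bad K t, 0 < A K t τ - shA K t τ)
    (hQ : ∀ (K : ℕ) (t : ℝ), |t| ≤ l₀ → ∀ τ ∈ T K \ Bad K t, 0 < B K t τ - shB K t τ) :
    (∃ δ : ℕ → ℝ, HybridNE7 l₀ vol T A B Bad W shA shB Wsh δ) ↔
      (∃ δ : ℕ → ℝ, Target vol l₀ δ Z) ∧
      ∃ ε : ℕ → ℝ, (∀ (K : ℕ) (t : ℝ), |t| ≤ l₀ → ∀ τ ∈ T K \ Bad K t, ∀ τ' ∈ T K \ Bad K t,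
        (Real.log (B K t τ - shB K t τ) - Real.log (A K t τ - shA K t τ)) - (Real.log (B K t τ' - shB K t τ') - Real.log (A K t τ' - shA K t τ'))
          ≤ 2 * (vol * ε K)) ∧ Summable ε := by
  constructor
  · rintro ⟨δ, h⟩
    exact ⟨⟨_, target_of_hybridNE7 h hvol hl₀ hZA hZB fun K t ht => by rw [← hZA K t ht]; exact hZ K t ht⟩, δ, classOsc_of_hybridNE7 h hP, h.summable⟩
  · rintro ⟨⟨δ, hM, hδ⟩, ε, hosc, hε⟩
    exact ⟨_, hybridNE7_of_matchingModConstants_of_classOsc hvol hW hSh hlt hZA hZB hZ hM hδ hP hQ hosc hε⟩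

/-- **★★ N19′'s OWN SLOT AT FIXED WEIGHTS** [folklore]: under the same standing hypotheses, leaf D's `h19` shape `∃ δ, Core … (A − shA) (B − shB) δ ∧ Summable δ` ⟺ node U5's
DECL target `∃ δ, NE7.Target vol l₀ δ Z` ∧ a summable `Hom` (⇒ through `NE7.hybridNE7_of_core`; ⇐ through §2's `HybridNE7.core`). -/
theorem coreEdge_iff_target_classOsc (hvol : 0 < vol) (hl₀ : 0 ≤ l₀) (hW : RelWeightBound l₀ T A B Bad W) (hSh : ShellWeightBound l₀ T A B shA shB Wsh)
    (hlt : ∀ K, W K + Wsh K < 1)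
    (hZA : ∀ (K : ℕ) (t : ℝ), |t| ≤ l₀ → Z K t = ∑ τ ∈ T K, A K t τ) (hZB : ∀ (K : ℕ) (t : ℝ), |t| ≤ l₀ → Z (K + 1) t = ∑ τ ∈ T K, B K t τ)
    (hZ : ∀ (K : ℕ) (t : ℝ), |t| ≤ l₀ → 0 < Z K t)
    (hP : ∀ (K : ℕ) (t : ℝ), |t| ≤ l₀ → ∀ τ ∈ T K \ Bad K t, 0 < A K t τ - shA K t τ)
    (hQ : ∀ (K : ℕ) (t : ℝ), |t| ≤ l₀ → ∀ τ ∈ T K \ Bad K t, 0 < B K t τ - shB K t τ) :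
    (∃ δ : ℕ → ℝ, Core l₀ vol T Bad (fun K t τ => A K t τ - shA K t τ) (fun K t τ => B K t τ - shB K t τ) δ ∧ Summable δ) ↔
      (∃ δ : ℕ → ℝ, Target vol l₀ δ Z) ∧
      ∃ ε : ℕ → ℝ, (∀ (K : ℕ) (t : ℝ), |t| ≤ l₀ → ∀ τ ∈ T K \ Bad K t, ∀ τ' ∈ T K \ Bad K t,
        (Real.log (B K t τ - shB K t τ) - Real.log (A K t τ - shA K t τ)) - (Real.log (B K t τ' - shB K t τ') - Real.log (A K t τ' - shA K t τ'))
          ≤ 2 * (vol * ε K)) ∧ Summable ε := by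
  rw [← hybridNE7Edge_iff_target_classOsc hvol hl₀ hW hSh hlt hZA hZB hZ hP hQ]
  constructor
  · rintro ⟨δ, hc, hδ⟩
    exact ⟨δ, hybridNE7_of_core hW hSh hlt hδ hc⟩
  · rintro ⟨δ, h⟩
    exact ⟨δ, h.core, h.summable⟩

/-! ## §5 The bracket's lower end: at most one good class per `(K, t)` [folklore] -/

/-- With at most ONE good class per `(K, t)` the letter `Hom(0)` holds trivially. [folklore] -/
theorem classOsc_of_goodSubsingleton {P Q : ℕ → ℝ → ι → ℝ} (hsub : ∀ (K : ℕ) (t : ℝ), |t| ≤ l₀ → ∀ τ ∈ T K \ Bad K t, ∀ τ' ∈ T K \ Bad K t, τ = τ') :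
    ∀ (K : ℕ) (t : ℝ), |t| ≤ l₀ → ∀ τ ∈ T K \ Bad K t, ∀ τ' ∈ T K \ Bad K t,
      (Real.log (Q K t τ) - Real.log (P K t τ)) - (Real.log (Q K t τ') - Real.log (P K t τ')) ≤ 2 * (vol * (0 : ℕ → ℝ) K) := by
  intro K t ht τ hτ τ' hτ'
  rw [hsub K t ht τ hτ τ' hτ', sub_self, Pi.zero_apply, mul_zero, mul_zero]

/-- **★ ONE GOOD CLASS: THE DECL TARGET AND THE WEIGHTS ALONE GIVE THE BINDER LIST** [folklore ∘ §2] — g0's `hybridNE7_twoClass_of_total` (index `Bool`, bad class `{true}`) for an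
arbitrary index and bad-class family: when every `(K, t)` has at most one good class, `MatchingModConstants vol l₀ δ Z` + NE7b + NE7c + `W + Wsh < 1` + `Summable δ` + positive good
cores ⇒ `HybridNE7 … (hybridDelta vol δ (W + Wsh))`. -/
theorem hybridNE7_of_matchingModConstants_of_goodSubsingleton (hvol : 0 < vol) (hW : RelWeightBound l₀ T A B Bad W) (hSh : ShellWeightBound l₀ T A B shA shB Wsh)
    (hlt : ∀ K, W K + Wsh K < 1)
    (hZA : ∀ (K : ℕ) (t : ℝ), |t| ≤ l₀ → Z K t = ∑ τ ∈ T K, A K t τ) (hZB : ∀ (K : ℕ) (t : ℝ), |t| ≤ l₀ → Z (K + 1) t = ∑ τ ∈ T K, B K t τ)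
    (hZ : ∀ (K : ℕ) (t : ℝ), |t| ≤ l₀ → 0 < Z K t) (hM : MatchingModConstants vol l₀ δ Z) (hδ : Summable δ)
    (hP : ∀ (K : ℕ) (t : ℝ), |t| ≤ l₀ → ∀ τ ∈ T K \ Bad K t, 0 < A K t τ - shA K t τ)
    (hQ : ∀ (K : ℕ) (t : ℝ), |t| ≤ l₀ → ∀ τ ∈ T K \ Bad K t, 0 < B K t τ - shB K t τ)
    (hsub : ∀ (K : ℕ) (t : ℝ), |t| ≤ l₀ → ∀ τ ∈ T K \ Bad K t, ∀ τ' ∈ T K \ Bad K t, τ = τ') :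
    HybridNE7 l₀ vol T A B Bad W shA shB Wsh (hybridDelta vol δ fun K => W K + Wsh K) := by
  have h := hybridNE7_of_matchingModConstants_of_classOsc hvol hW hSh hlt hZA hZB hZ hM hδ hP hQ
    (classOsc_of_goodSubsingleton (P := fun K t τ => A K t τ - shA K t τ) (Q := fun K t τ => B K t τ - shB K t τ) hsub) summable_zero
  have e : (fun K => hybridDelta vol δ (fun K => W K + Wsh K) K + 2 * (0 : ℕ → ℝ) K) = hybridDelta vol δ (fun K => W K + Wsh K) :=
    funext fun K => by rw [Pi.zero_apply, mul_zero, add_zero]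
  rw [e] at h
  exact h

end Hybrid

/-! ## §6 The disprover's handle: an unsummable class gap on the good cores kills the edge at that reading [folklore] -/

section Gap
variable {P Q : ℕ → ℝ → ι → ℝ} {g : ℕ → ℝ}

/-- **KERNEL GUARD** [folklore]: if at every level `K` some admissible source value exhibits two GOOD classes whose log-ratio `log Q − log P` differs by at least `g_K ≥ 0`
(run-A cores positive there), then every `Core … δ` has `g_K ≤ 2·vol·δ_K`; so if `g` is NOT summable, N19′'s slot `∃ δ, Core … δ ∧ Summable δ` FAILS at this reading —
g0's `exists_totalCore_not_core` (gap `log 2`, constant) as a criterion.  (A statement about ONE reading; the crux's dials — key, cut policy, shell split — are the prover's.) -/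
theorem not_coreEdge_of_unsummable_gap (hg0 : ∀ K, 0 ≤ g K) (hg : ¬ Summable g)
    (hgap : ∀ K : ℕ, ∃ t : ℝ, |t| ≤ l₀ ∧ ∃ τ ∈ T K \ Bad K t, ∃ τ' ∈ T K \ Bad K t, 0 < P K t τ ∧ 0 < P K t τ' ∧
      g K ≤ (Real.log (Q K t τ) - Real.log (P K t τ)) - (Real.log (Q K t τ') - Real.log (P K t τ')))
    : ¬ ∃ δ : ℕ → ℝ, Core l₀ vol T Bad P Q δ ∧ Summable δ := by
  rintro ⟨δ, hC, hδ⟩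
  refine hg (Summable.of_nonneg_of_le hg0 (fun K => ?_) ((hδ.mul_left vol).mul_left 2))
  obtain ⟨t, ht, τ, hτ, τ', hτ', hPτ, hPτ', hle⟩ := hgap K
  exact hle.trans (logRatio_sub_logRatio_le_of_core hC K ht ht hτ hτ' hPτ hPτ')

end Gap

section GapHybrid
variable {A B shA shB : ℕ → ℝ → ι → ℝ} {W Wsh : ℕ → ℝ} {g : ℕ → ℝ}

/-- … and the same for the whole binder list: an unsummable good-core class gap excludes `∃ δ, HybridNE7 … δ` at this reading, WHATEVER the weights. [folklore] -/
theorem not_hybridNE7Edge_of_unsummable_gap (hg0 : ∀ K, 0 ≤ g K) (hg : ¬ Summable g)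
    (hgap : ∀ K : ℕ, ∃ t : ℝ, |t| ≤ l₀ ∧ ∃ τ ∈ T K \ Bad K t, ∃ τ' ∈ T K \ Bad K t, 0 < A K t τ - shA K t τ ∧ 0 < A K t τ' - shA K t τ' ∧
      g K ≤ (Real.log (B K t τ - shB K t τ) - Real.log (A K t τ - shA K t τ)) - (Real.log (B K t τ' - shB K t τ') - Real.log (A K t τ' - shA K t τ')))
    : ¬ ∃ δ : ℕ → ℝ, HybridNE7 l₀ vol T A B Bad W shA shB Wsh δ := by
  rintro ⟨δ, h⟩
  exact not_coreEdge_of_unsummable_gap (P := fun K t τ => A K t τ - shA K t τ) (Q := fun K t τ => B K t τ - shB K t τ) hg0 hg hgap ⟨δ, h.core, h.summable⟩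

end GapHybrid

/-! ## §7 `Hom` split along the source: vacuum class-homogeneity + class-homogeneity of the source RESPONSE [folklore] -/

section ResponseSplit
variable {A B shA shB : ℕ → ℝ → ι → ℝ} {W Wsh δ ε₀ ε₁ : ℕ → ℝ} {Z : ℕ → ℝ → ℝ}

/-- **`Hom` FROM (V₀) ∧ (H)** [folklore, arithmetic]: if at zero source the good cores' log-ratio `X(0,·)` has class-oscillation `≤ 2·vol·ε⁰_K` over the classes good at `t`
((V₀): dag-n19-e's vacuum half `…N19SourceSplit` (V) in its constant-free form) and the SOURCE RESPONSE `X(t,·) − X(0,·)` has class-oscillation `≤ 2·vol·ε¹_K` ((H) — WEAKER than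
(I) «per-class response small»: the response may be large provided it is the same for all good classes), then `Hom(ε⁰ + ε¹)`. -/
theorem classOsc_of_vacuumOsc_of_responseOsc {X : ℕ → ℝ → ι → ℝ}
    (hV : ∀ (K : ℕ) (t : ℝ), |t| ≤ l₀ → ∀ τ ∈ T K \ Bad K t, ∀ τ' ∈ T K \ Bad K t, X K 0 τ - X K 0 τ' ≤ 2 * (vol * ε₀ K))
    (hH : ∀ (K : ℕ) (t : ℝ), |t| ≤ l₀ → ∀ τ ∈ T K \ Bad K t, ∀ τ' ∈ T K \ Bad K t, (X K t τ - X K 0 τ) - (X K t τ' - X K 0 τ') ≤ 2 * (vol * ε₁ K)) :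
    ∀ (K : ℕ) (t : ℝ), |t| ≤ l₀ → ∀ τ ∈ T K \ Bad K t, ∀ τ' ∈ T K \ Bad K t, X K t τ - X K t τ' ≤ 2 * (vol * (ε₀ K + ε₁ K)) := by
  intro K t ht τ hτ τ' hτ'
  have h1 := hV K t ht τ hτ τ' hτ'
  have h2 := hH K t ht τ hτ τ' hτ'
  have e : X K t τ - X K t τ' = (X K 0 τ - X K 0 τ') + ((X K t τ - X K 0 τ) - (X K t τ' - X K 0 τ')) := by ring
  rw [e, mul_add, mul_add]
  exact add_le_add h1 h2

/-- **★★ THE THREE-LETTER FORM OF THE CONVERSE ROAD** [folklore ∘ §2]: node U5's DECL-target currency `MatchingModConstants vol l₀ δ Z` + NE7b + NE7c + `W + Wsh < 1` + `Summable δ` +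
positive good cores + (V₀) summable + (H) summable ⇒ `HybridNE7 … (hybridDelta vol δ (W + Wsh) + 2(ε⁰ + ε¹))`.  Every matching constant lives in the DECL target; (V₀) and (H) are
constant-free and read source value by source value; (H) replaces dag-n19-e's per-class response letter (I) by its class-oscillation — the common response is booked by the target. -/
theorem hybridNE7_of_matchingModConstants_of_vacuumOsc_of_responseOsc (hvol : 0 < vol) (hW : RelWeightBound l₀ T A B Bad W)
    (hSh : ShellWeightBound l₀ T A B shA shB Wsh) (hlt : ∀ K, W K + Wsh K < 1)
    (hZA : ∀ (K : ℕ) (t : ℝ), |t| ≤ l₀ → Z K t = ∑ τ ∈ T K, A K t τ) (hZB : ∀ (K : ℕ) (t : ℝ), |t| ≤ l₀ → Z (K + 1) t = ∑ τ ∈ T K, B K t τ)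
    (hZ : ∀ (K : ℕ) (t : ℝ), |t| ≤ l₀ → 0 < Z K t) (hM : MatchingModConstants vol l₀ δ Z) (hδ : Summable δ)
    (hP : ∀ (K : ℕ) (t : ℝ), |t| ≤ l₀ → ∀ τ ∈ T K \ Bad K t, 0 < A K t τ - shA K t τ)
    (hQ : ∀ (K : ℕ) (t : ℝ), |t| ≤ l₀ → ∀ τ ∈ T K \ Bad K t, 0 < B K t τ - shB K t τ)
    (hV : ∀ (K : ℕ) (t : ℝ), |t| ≤ l₀ → ∀ τ ∈ T K \ Bad K t, ∀ τ' ∈ T K \ Bad K t,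
      (Real.log (B K 0 τ - shB K 0 τ) - Real.log (A K 0 τ - shA K 0 τ)) - (Real.log (B K 0 τ' - shB K 0 τ') - Real.log (A K 0 τ' - shA K 0 τ')) ≤ 2 * (vol * ε₀ K))
    (hH : ∀ (K : ℕ) (t : ℝ), |t| ≤ l₀ → ∀ τ ∈ T K \ Bad K t, ∀ τ' ∈ T K \ Bad K t,
      ((Real.log (B K t τ - shB K t τ) - Real.log (A K t τ - shA K t τ)) - (Real.log (B K 0 τ - shB K 0 τ) - Real.log (A K 0 τ - shA K 0 τ))) -
        ((Real.log (B K t τ' - shB K t τ') - Real.log (A K t τ' - shA K t τ')) - (Real.log (B K 0 τ' - shB K 0 τ') - Real.log (A K 0 τ' - shA K 0 τ')))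
          ≤ 2 * (vol * ε₁ K))
    (hε₀ : Summable ε₀) (hε₁ : Summable ε₁) :
    HybridNE7 l₀ vol T A B Bad W shA shB Wsh (fun K => hybridDelta vol δ (fun K => W K + Wsh K) K + 2 * (ε₀ K + ε₁ K)) :=
  hybridNE7_of_matchingModConstants_of_classOsc hvol hW hSh hlt hZA hZB hZ hM hδ hP hQ
    (classOsc_of_vacuumOsc_of_responseOsc (X := fun K t τ => Real.log (B K t τ - shB K t τ) - Real.log (A K t τ - shA K t τ)) hV hH) (hε₀.add hε₁)

/-- **NECESSITY OF (V₀) AND (H)** [folklore]: the hybrid binder list at rate `δ` (positive run-A good cores, `0 ≤ l₀`, a class good at `t` is good at `0`) has (V₀) at rate `δ` and (H)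
at rate `2δ` (§3 at `t` and at `0`). -/
theorem vacuumOsc_responseOsc_of_hybridNE7 (h : HybridNE7 l₀ vol T A B Bad W shA shB Wsh δ) (hl₀ : 0 ≤ l₀)
    (hBad : ∀ (K : ℕ) (t : ℝ), |t| ≤ l₀ → Bad K 0 ⊆ Bad K t)
    (hP : ∀ (K : ℕ) (t : ℝ), |t| ≤ l₀ → ∀ τ ∈ T K \ Bad K t, 0 < A K t τ - shA K t τ) :
    (∀ (K : ℕ) (t : ℝ), |t| ≤ l₀ → ∀ τ ∈ T K \ Bad K t, ∀ τ' ∈ T K \ Bad K t,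
      (Real.log (B K 0 τ - shB K 0 τ) - Real.log (A K 0 τ - shA K 0 τ)) - (Real.log (B K 0 τ' - shB K 0 τ') - Real.log (A K 0 τ' - shA K 0 τ')) ≤ 2 * (vol * δ K)) ∧
    (∀ (K : ℕ) (t : ℝ), |t| ≤ l₀ → ∀ τ ∈ T K \ Bad K t, ∀ τ' ∈ T K \ Bad K t,
      ((Real.log (B K t τ - shB K t τ) - Real.log (A K t τ - shA K t τ)) - (Real.log (B K 0 τ - shB K 0 τ) - Real.log (A K 0 τ - shA K 0 τ))) -
        ((Real.log (B K t τ' - shB K t τ') - Real.log (A K t τ' - shA K t τ')) - (Real.log (B K 0 τ' - shB K 0 τ') - Real.log (A K 0 τ' - shA K 0 τ')))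
          ≤ 2 * (vol * (2 * δ K))) := by
  have h0 : |(0 : ℝ)| ≤ l₀ := by rw [abs_zero]; exact hl₀
  have good0 : ∀ (K : ℕ) (t : ℝ), |t| ≤ l₀ → ∀ τ ∈ T K \ Bad K t, τ ∈ T K \ Bad K 0 := fun K t ht τ hτ =>
    Finset.mem_sdiff.mpr ⟨(Finset.mem_sdiff.mp hτ).1, fun hb => (Finset.mem_sdiff.mp hτ).2 (hBad K t ht hb)⟩
  have hom := classOsc_of_hybridNE7 h hP
  refine ⟨fun K t ht τ hτ τ' hτ' => hom K 0 h0 τ (good0 K t ht τ hτ) τ' (good0 K t ht τ' hτ'), fun K t ht τ hτ τ' hτ' => ?_⟩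
  have h1 := hom K t ht τ hτ τ' hτ'
  have h2 := hom K 0 h0 τ' (good0 K t ht τ' hτ') τ (good0 K t ht τ hτ)
  linarith

end ResponseSplit

end Summit.QuantumFields.YangMills.BalabanUVNodes.N19HybridBeyondTarget

end
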